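import Literature.Topology.FourManifolds.HomotopySpheresBP
import Literature.Topology.FourManifolds.Handles
import Literature.Topology.FourManifolds.IntersectionLattice
import HarnessLib

/-!
# Wall 1964, Lemma 2: a simply connected bounding 5-manifold of the homotopy type of a bouquet
# of 2-spheres gives an h-cobordism to a handlebody boundary (named fact)

Topic `Literature/Topology/FourManifolds`; a leaf of the decomposition of Wall's Thm. 2
(`Literature.Topology.FourManifolds.isHCobordant_of_equivalent_intersectionForm`,
`HCobordismDonaldson.lean`; layer 1 `HCobordismWall.lean`, layer 2 `HCobordismWallDuality.lean`)
along its printed proof. C. T. C. Wall, *On simply-connected 4-manifolds*, J. London Math. Soc. 39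
(1964) 141–149, opens the proof of Thm. 2 (§2, p. 144) with: "Form the connected sum
`N = M₁ # (−M₂)`. Since the signatures of `M₁` and `M₂` are equal, that of `N` is zero … by
Theorem 1 and Lemma 2, `N` is h-cobordant to a handlebody boundary `∂V`." Of these two printed
inputs only Lemma 2 is vendored here as a named fact; Theorem 1 is deliberately NOT (see below).

* NAMED FACT `exists_handlebody_isHCobordant_boundary` — **Lemma 2** (pp. 143–144): "Let
  `∂W⁵ = M⁴`, where `W` and `M` are 1-connected, and `W` has the homotopy type of a bouquet of `k`
  2-spheres. Then (i) `W` admits a handlebody `H ∈ ℋ(5, k, 2)` as deformation retract, (ii) The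
  closure `C` of `W − H` gives an h-cobordism of `M` to `∂H`." We vendor conclusion (ii) together
  with the existence of `H` (a compact smooth 5-manifold with boundary admitting a handle
  decomposition with one `0`-handle and `k = rank H₂(W)` `2`-handles, the tree's
  `HasHandleDecomposition`), which is what §2 consumes (the handlebody `V = H` and the h-cobordism
  from `N` to `∂V`); the deformation retraction (i) and the identification `C = W − H̊` are not
  restated (weaker, never stronger).

The remaining printed inputs of §2 — the structure of `∂V` as a connected sum of `S²`-bundles over
`S²` ([10] = Wall, *Classification problems in differential topology (I)*, Topology 2 (1963)) and
the realisation of automorphs of `H₂(∂V)` by diffeomorphisms ([11] = Wall, *Diffeomorphisms of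
4-manifolds*, J. London Math. Soc. 39 (1964), Cor. to Thm. 2) — are the named facts of
`WallHandlebodyBoundary.lean`; the algebraic lemma on Lagrangians is PROVED in
`LatticeFormsLagrangian.lean` (`exists_isometryEquiv_map_eq_of_isotropic`). Nothing here is
discharged yet. Wall's own line of proof (embedded 2-discs realising `H₂(W)`, a smooth regular
neighbourhood, Lefschetz duality for the triad `(C; M, ∂H)`) needs embedding and
tubular-neighbourhood theory that Mathlib and the tree lack; but Milnor's handle calculus of
cobordisms of dimension `≥ 5`, which the tree has meanwhile PROVED to a large extent, gives a
second line along which the fact is provable without any new named fact — see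
`## Route to the discharge` below (recorded by the D-0026 review of this decomposition child,
2026-08-15; the statement itself is unchanged).

## Why Theorem 1 is not a named fact of this file (merged back into the parent's obligation)

Wall's **Thm. 1** (p. 142: "Let `M⁴` be simply-connected, and `σ(M⁴) = 0`. Then `M⁴` bounds a
manifold `W⁵` of the homotopy type of a bouquet of 2-spheres") was vendored by the first version
of this file as the named fact `exists_nullCobordism_of_signature_eq_zero` (conclusion in the
homological form Wall establishes on p. 143: a `NullCobordism 4 M` whose total space is simply
connected with `Hₖ = 0` for `k ≥ 3` and `H₂` finitely generated free), together with the
three-line composition `exists_handlebody_isHCobordant_boundary_of_signature_eq_zero` of the two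
facts (the sentence of p. 144 quoted above, for one manifold `N`). Both declarations are retired
(review of the decomposition under D-0026: an unprovable child of an unproved parent), and the
content of Thm. 1 is returned to the proof obligation of the layer-2 geometric fact
`exists_cobordism_isZero_relativeSingularHomology_le_two_of_equivalent_intersectionForm`
(`HCobordismWallDuality.lean`, whose docstring lists Thm. 1 among its contents), for two reasons
read off the printed proof:

1. *Thm. 1 is not below Thm. 2 in Wall's own order of proof.* Pages 142–143 prove it for
   rank `H₂(M) ≥ 4` only ("We temporarily impose the restriction that the rank of `H₂(M)` be at
   least 4", p. 143); rank `0` is referred to [9] (Wall, *Killing the middle homotopy groups of odd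
   dimensional manifolds*, Trans. Amer. Math. Soc. 103 (1962) 421–433: a homotopy 4-sphere bounds
   a contractible manifold — by Kervaire–Milnor's Lemma 2.3 the statement `Θ₄ = 0`, which the
   tree derives FROM Thm. 2 in `ThetaFourWall.lean`); and rank `2` is settled only on p. 146,
   after Thm. 2 and through it ("We now return to the unsettled case of Theorem 1. If the rank of
   `H₂(M)` is equal to 2, and `σ(M) = 0`, then the quadratic form of `M` has one of two types and
   these are the quadratic forms of `S` and `T`. By the result above `M` is h-cobordant to `S` or
   `T`, and then filling in the 2-sphere bundle `S(T)` by the 3-disc bundle, we obtain the required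
   manifold with boundary `M`"). §2 itself consumes only "the part of Theorem 1 already proved"
   (p. 144), for `N = M₁ # (−M₂)` with rank `H₂(M₁) ≠ 1`, and closes the rank-1 case last
   (p. 146). A decomposition child of Thm. 2 consisting of Thm. 1 in full generality can therefore
   not be discharged before its parent.
2. *It is a theory, not a lemma.* The printed proof rests on Thom's `Ω₄ ≅ ℤ` detected by the
   signature ([7]; in the tree the named fact `isOrientedBordant_of_signature_eq`,
   `BordismFourProofs.lean`, itself undischarged), on Lemma 1 (p. 142: a spin bounding manifold when
   `w₂(M) = 0`, by the Adams spectral sequence for `Ω₄^Spin → Ω₄`), on Milnor's surgery theorem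
   making `V⁵` simply connected ([5], Thm. 3), and on spherical modifications along embedded
   2-spheres with trivial normal bundle (`w₂(y) = 0`) killing first the infinite part and then the
   torsion of `H₂(V, M)` (the exact sequences `(S)`, `(S')` of p. 142; Lefschetz duality, universal
   coefficients and primitive elements on p. 143). Oriented and spin cobordism, Stiefel–Whitney
   classes, surgery below the middle dimension and the homology calculus of spherical
   modifications are all absent from Mathlib and from the tree (whose `CircleSurgery*.lean` and
   `SphereFamilySurgery.lean` construct surgered manifolds as open gluings and stop there).

Nothing proved is lost (the composition was an `obtain`/`exact`), no statement of the tree used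
either declaration, and the printed statement with its locator (Thm. 1, p. 142; proof
pp. 142–143 and p. 146) is recorded above for the seat that will decompose the layer-2 fact once
the theory is in hand.

## Route to the discharge (D-0026 review, 2026-08-15): the Morse-theoretic line

Not Wall's embedded discs but Milnor, *Lectures on the h-cobordism theorem* (1965), §§2–4, 7–8,
applied to the 5-dimensional cobordism obtained from `W` by removing a ball — every rung named
here is a theorem of the tree (`_holds`, axiom-clean) unless marked UPSTREAM:

1. *Ball removal.* For an interior chart ball `B ⊂ W`, `K = W ∖ B̊` is a cobordism from `𝕊⁴` to
   `M` (`BallRemovalData.cobordism`, `BallRemovalCobordism.lean`, reversed), simply connected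
   (`Literature.AlgebraicTopology.FundamentalGroupoid.isSimplyConnected_compl_singleton_of_isOpenEmbedding`,
   as in `BallRemovalData.simplyConnectedSpace_K` with contractibility weakened to simple
   connectivity), and `Hᵢ(K, 𝕊⁴; ℤ)` is `ℤᵏ` for `i = 2` (`k = rank H₂(W)`) and `0` otherwise
   (Mayer–Vietoris for `W = K ∪ B` and the sequence of the pair, from the hypotheses on `W`;
   `Literature/AlgebraicTopology/SingularHomology/ExcisionMayerVietorisProofs.lean`).
2. *Only 2- and 3-handles.* A Morse function on `K` (Thm. 2.5,
   `Cobordism.exists_isMorseFunction_holds`); cancel the critical points of index `0` and trade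
   those of index `1` at the `𝕊⁴` end (Thm. 8.1, `Cobordism.Milnor1965_cancel_index_zero_holds`,
   `Cobordism.Milnor1965_trade_index_one_holds` — `dim K = 5`, `K` and `𝕊⁴` simply connected,
   `simplyConnectedSpace_sphere`), turn about (`Cobordism.IsMorseFunction.symm`) and do the same at
   the `M` end (`M` simply connected), as in the proof of
   `Milnor1965_exists_isMorseFunction_two_le_index_holds` with its h-cobordism hypothesis replaced
   by the simple connectivity of `K`, `𝕊⁴` and `M` (all that the two Thm. 8.1 facts ask for);
   make the function nice (Thm. 4.8, `Cobordism.Milnor1965_finalRearrangement_holds`) and choose a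
   gradient-like field (`Cobordism.Milnor1965_exists_isGradientLike_holds`).
3. *The handle chain complex* `0 → C₃ → C₂ → 0` has `C_λ` free of rank the number of critical
   points of index `λ` (`Milnor1965_morseHomology_free_holds`) and homology `H⁎(K, 𝕊⁴)` (Thm. 7.4,
   `Cobordism.Milnor1965_morseComplex_homology_holds`); so `∂` is injective with free cokernel
   `≅ H₂(K, 𝕊⁴) ≅ ℤᵏ`, and `C₂` has a basis whose first `k` vectors project onto a basis of the
   cokernel (pure algebra). Handle slides are unavoidable here: for `∂(1) = (2, 3)` no subset of
   the geometric basis complements the image.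
4. *Handle slides and reordering.* UPSTREAM named fact `Cobordism.Milnor1965_basisTheorem_slab`
   (`HCobordismBasisTheorem.lean`; Thm. 7.6 on the index-2 slab, within its bounds `2 ≤ λ`,
   `λ + 2 ≤ dim K = 5`) realises that basis by left-hand discs with all index-2 points on one
   level; Thms. 4.1/4.2 on the slab (`Milnor1965_rearrangement_slab_holds`; the `K`-sets of points
   on a common level are disjoint, cf. Thm. 4.4,
   `Cobordism.Milnor1965_exists_isGradientLike_disjoint_spheres_slab_holds`) then put the `k` chosen
   points on a level `a` below the level `a'` of the others. Fix a
   regular value `m ∈ (a, a')`, `L = {g = m}`, `C = {g ≥ m} ⊆ K`.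
5. *`H⁎(C, L) = 0` without looking at the 3-handles:* `H₂({g ≤ m}, 𝕊⁴)` is free on the `k`
   disc classes (`Cobordism.Milnor1965_homology_oneLevel_slab_holds`) and maps isomorphically onto
   `H₂(K, 𝕊⁴)` by 3–4, while `Hᵢ(K, 𝕊⁴) = 0` for `i ≠ 2`; the exact sequence of the triple
   `𝕊⁴ ⊂ {g ≤ m} ⊂ K` and excision give `H⁎(K, {g ≤ m}) ≅ H⁎(C, L) = 0`. The level `L` and `C`
   are simply connected (van Kampen through the handles: parts (1) and (3) of
   `Cobordism.Milnor1965_simplyConnected_levels_holds`, to be re-derived for `K`, which is not an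
   h-cobordism — only the simple connectivity of the lower end enters those two parts in print,
   Milnor PDF pp. 53, 56).
6. *Duality and recognition.* `C` is a cobordism from `L` to `M` (the part of a cobordism above
   a regular level: half-slice charts at `L` as in `RegularSublevelSet.lean`/`RegularLevelSet.lean`,
   the charts of `K` at `M` — to be assembled); the UPSTREAM named fact
   `Cobordism.isZero_relativeSingularHomology_inl_of_inr_le` (`HCobordismWallDuality.lean`,
   Poincaré–Lefschetz duality for cobordisms; some duality is needed by ANY proof, Wall's
   "`Hᵢ(C, M) ≅ H⁵⁻ⁱ(C, ∂H)`") turns `H⁎(C, L) = 0` into `H⁎(C, M) = 0`, and the proved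
   recognition theorem `Cobordism.isHCobordism_of_isZero_relativeSingularHomology`
   (`HCobordismWall.lean`, fed with `whitehead_exists_homotopyEquiv_holds`,
   `exists_cwComplex_homotopyEquiv_of_compactSpace_holds`,
   `exists_cwComplex_homotopyEquiv_of_compactSpace_boundary_holds`) makes `C` an h-cobordism.
7. *The handlebody.* `H = B ∪ {g ≤ m} ⊆ W` is a compact 5-manifold with boundary `{g = m} ≅ L`
   carrying an adapted Morse function with one critical point of index `0` (the centre of `B`)
   and the `k` chosen ones of index `2` — the function `g`, first straightened to the product
   coordinate on a flow collar of the `𝕊⁴` end (`SlabProduct.lean`) and then spliced with the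
   radial function of `B` (the pattern of `LevelSplicing.lean`, `LevelSplicingMorse.lean`) — so
   `HasHandleDecomposition 4 H (twoHandlebodyCount k)` (cf. `RegularLevelSplitting.lean`,
   `RegularSublevel.hasHandleDecomposition`), and transporting `C` along `(𝓡∂ 5).boundary H ≅ L`
   gives `IsHCobordant 4 M ((𝓡∂ 5).boundary H)`.

So the discharge is
`theorem exists_handlebody_isHCobordant_boundary_of_facts (hB : …basisTheorem_slab)
(hD : …isZero_relativeSingularHomology_inl_of_inr_le) : exists_handlebody_isHCobordant_boundary`
(to be proved in a sibling proofs file, bottom-up: items 1, 3, 5, 6, 7 are the new intermediate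
results) followed by `_holds` once the two upstream facts are discharged. Size L, not XL; no new
named fact is needed or allowed (D-0026).

## Faithfulness notes

* Wall's manifolds are closed, oriented, smooth (p. 141). "`∂W⁵ = M⁴`" is the tree's unoriented
  `NullCobordism 4 M` (a compact smooth 5-manifold with boundary and a smooth embedding `M ↪ W`
  onto `∂W`, `HomotopySpheresBP.lean`); Wall's `W` is simply connected, hence orientable, and
  `∂W = M` orientedly after fixing the orientation of `W`, so the unoriented reading is implied by
  the printed one.
* The hypothesis "`W` has the homotopy type of a bouquet of `k` 2-spheres" is taken in the
  homological form in which Thm. 1 delivers it and in which Wall himself passes to the bouquet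
  (p. 143: "a simply-connected manifold `W` whose only nonzero homology group is `H₂(W)`, which is
  free … Thus `W` has the homotopy type of a bouquet of 2-spheres"): `W` simply connected,
  `Hₖ(W; ℤ) = 0` for `k ≥ 3`, `H₂(W; ℤ)` finitely generated free of rank `k`; for a compact manifold
  (CW homotopy type) the two are equivalent by Hurewicz and Whitehead.
* `ℋ(5, k, 2)` (Smale's handlebodies [6]: `D⁵` with `k` handles of index `2` attached) is rendered
  by `HasHandleDecomposition 4 H c` with `c 0 = 1`, `c 2 = k`, `c i = 0` otherwise (an adapted
  Morse function with these critical-point counts; Kosinski VII.1.1 for the equivalence with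
  handle presentations, as recorded in `Handles.lean`); `∂H` is the subtype `(𝓡∂ 5).boundary H`
  with its smooth structure (`BoundaryManifold`, `Cobordism.lean`).
* All manifolds live in `Type` (as in the target fact).

## References

* C. T. C. Wall, *On simply-connected 4-manifolds*, J. London Math. Soc. 39 (1964) 141–149:
  Lemma 1 and Thm. 1 (p. 142, proof pp. 142–143 and p. 146), Lemma 2 (pp. 143–144), §2 (p. 144),
  references [5], [7], [9], [10], [11] (p. 149). [WallJLMS1964]
* S. Smale, *Generalized Poincaré's conjecture in dimensions greater than four*, Ann. of Math. 74
  (1961) 391–406 (handlebodies `ℋ(n, k, s)`; Wall's reference [6]).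
* J. Milnor, *Lectures on the h-cobordism theorem*, notes by L. Siebenmann and J. Sondow,
  Princeton (1965): Thm. 2.5, Thms. 4.1–4.2, 4.4, 4.8, Thms. 7.4, 7.6, Thm. 8.1 (the route to
  the discharge). [MilnorHCobordism1965]
* A. Hatcher, *Algebraic Topology*, CUP (2002), Thm. 3.43, Cor. 4.33, Cor. A.12 (duality and
  recognition steps of the route). [HatcherAT2002]
-/

noncomputable section

open scoped Manifold ContDiff
open CategoryTheory CategoryTheory.Limits
open Literature.AlgebraicTopology.SingularHomology

namespace Literature.Topology.FourManifolds

/-- Local notation: `𝔼 n` is the model Euclidean space `EuclideanSpace ℝ (Fin n)`. -/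
local notation "𝔼 " n:arg => EuclideanSpace ℝ (Fin n)

/-- The handle numbers of Smale's handlebodies `ℋ(5, k, 2)`: one handle of index `0` (the disc
`D⁵`), `k` handles of index `2`, none of other indices — as an argument for the tree's
`HasHandleDecomposition`. [cite: WallJLMS1964, Lemma 2 (p. 143)] -/
def twoHandlebodyCount (k : ℕ) : ℕ → ℕ := fun i => if i = 0 then 1 else if i = 2 then k else 0

/-- `twoHandlebodyCount k 0 = 1`. [folklore] -/
@[simp] theorem twoHandlebodyCount_zero (k : ℕ) : twoHandlebodyCount k 0 = 1 := rfl

/-- `twoHandlebodyCount k 2 = k`. [folklore] -/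
@[simp] theorem twoHandlebodyCount_two (k : ℕ) : twoHandlebodyCount k 2 = k := rfl

/-- `twoHandlebodyCount k i = 0` for `i ∉ {0, 2}`. [folklore] -/
theorem twoHandlebodyCount_of_ne {k i : ℕ} (h0 : i ≠ 0) (h2 : i ≠ 2) :
    twoHandlebodyCount k i = 0 := by
  simp [twoHandlebodyCount, h0, h2]

/-! ### Wall 1964, Lemma 2 -/

/-- NAMED FACT (**Wall 1964, Lemma 2**; C. T. C. Wall, *On simply-connected 4-manifolds*, J. London
Math. Soc. 39 (1964), pp. 143–144: "Let `∂W⁵ = M⁴`, where `W` and `M` are 1-connected, and `W`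
has the homotopy type of a bouquet of `k` 2-spheres. Then (i) `W` admits a handlebody
`H ∈ ℋ(5, k, 2)` as deformation retract, (ii) The closure `C` of `W − H` gives an h-cobordism of
`M` to `∂H`."). **If the closed smooth simply connected 4-manifold `M` (in `Type`) bounds a compact
smooth 5-manifold `W` (`NullCobordism 4 M`) which is simply connected with `Hₖ(W; ℤ) = 0` for
`k ≥ 3` and `H₂(W; ℤ)` finitely generated free of rank `k`, then there is a compact smooth
5-manifold with boundary `H` admitting a handle decomposition with one `0`-handle and `k`
`2`-handles (`HasHandleDecomposition 4 H (twoHandlebodyCount k)`, Smale's `ℋ(5, k, 2)`) such that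
`M` is smoothly h-cobordant to `∂H`** (the subtype `(𝓡∂ 5).boundary H` with its smooth structure,
`BoundaryManifold`). This is conclusion (ii) with the existence of `H`; the deformation
retraction (i) and the identification of the h-cobordism with `W − H̊` are not restated (weaker,
never stronger); the hypothesis is the homological form of "homotopy type of a bouquet of `k`
2-spheres" that Thm. 1 delivers. Printed proof (p. 144): embed `D⁵` and then discs `Dᵢ²` with
boundaries on `∂D⁵` representing generators of `H₂(W)` (disjoint, "in these dimensions, the
imbedding is easy"); a smooth neighbourhood is `H`, the inclusion `H → W` is a homology
equivalence of simply connected spaces, and `C` is simply connected (codimension `3`) with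
`Hᵢ(C, M) ≅ H⁵⁻ⁱ(C, ∂H) = 0`. Not proved here yet: Wall's embedding route needs embedding and
tubular-neighbourhood theory absent from Mathlib and the tree, but the fact is provable along
Milnor's handle calculus of 5-dimensional cobordisms, largely PROVED in the tree — see the module
docstring, `## Route to the discharge`, with its two upstream named facts
(`Cobordism.Milnor1965_basisTheorem_slab`,
`Cobordism.isZero_relativeSingularHomology_inl_of_inr_le`). Users take
`(h : exists_handlebody_isHCobordant_boundary)`. [cite: WallJLMS1964, Lemma 2 (pp. 143–144)] -/
def exists_handlebody_isHCobordant_boundary : Prop :=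
  ∀ (M : Type) [TopologicalSpace M] [T2Space M] [SecondCountableTopology M]
    [ChartedSpace (𝔼 4) M] [CompactSpace M] [IsManifold (𝓡 4) ∞ M] [SimplyConnectedSpace M]
    (c : NullCobordism.{0} 4 M), SimplyConnectedSpace c.W →
    (∀ k : ℕ, 3 ≤ k → IsZero (singularHomology ℤ ℤ c.W k)) →
    Module.Free ℤ (singularHomology ℤ ℤ c.W 2) → Module.Finite ℤ (singularHomology ℤ ℤ c.W 2) →
    ∃ (H : Type) (_ : TopologicalSpace H) (_ : T2Space H) (_ : SecondCountableTopology H)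
      (_ : ChartedSpace (EuclideanHalfSpace (4 + 1)) H) (_ : IsManifold (𝓡∂ (4 + 1)) ∞ H)
      (_ : CompactSpace H),
      HasHandleDecomposition 4 H
          (twoHandlebodyCount (Module.finrank ℤ (singularHomology ℤ ℤ c.W 2))) ∧
        IsHCobordant 4 M ((𝓡∂ (4 + 1)).boundary H)

end Literature.Topology.FourManifolds

end
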